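import Literature.Probability.LatticeModels.TreeGraphWickCurrents
import HarnessLib

/-!
# Deviation from Wick's law, tree-diagram form — II: the pairing recursion and the bound for current ratios

Topic `Literature/Probability/LatticeModels`. Pure algebra of the Gaussian pairing functional indexed by
finite subsets (`fsPairing S₂ B = ∑_{pairings of B} ∏ S₂`, defined by expansion at the least element), the
tree remainder `fsRemainder T S₂ B = ∑_{s ⊆ B, |s| = 4} T(s) · fsPairing S₂ (B ∖ s)`, and the recursion
("greedy pairing") turning a bound on the excess of ONE Gaussian step,
`∑_{j ≠ m} S₂(m,j) S(B∖{m,j}) - S(B) ≤ c ∑_{s ∋ m} T(s) fsPairing(B∖s)` (`m = min B`), into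
`fsPairing(B) - S(B) ≤ c · fsRemainder(B)`; then the random-current input of
`TreeGraphWickCurrents.lean` gives, for the current ratios `W(A) = Z_K[A]/Z_K[∅]` of edge couplings `K ≥ 0`
on a finite simple graph and every vertex set `B` of even size,

  `0 ≤ fsPairing W₂ B - W(B) ≤ 2 · fsRemainder T W₂ B`,  `W₂(a,b) = W({a}Δ{b})`,
  `T(s) = ∑_u ∏_{i∈s} W({i}Δ{u})`

(`Current.cratio_le_fsPairing`, `Current.fsPairing_sub_cratio_le`, `Current.abs_cratio_sub_fsPairing_le`): the tree-diagram form of Aizenman's bound on the deviation from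
Wick's law (Aizenman 1982, Prop. 12.1 combined with the tree diagram bound Prop. 5.3; Panis 2023, Prop. 4.6
and §4.2), with constant `2` in place of `(3/2)·2 = 3`, for distinct points. Coincident points and the
identification with the tree's `pairingSum`/`wickRemainder` are in `TreeGraphWickPairing.lean`.

## References

* M. Aizenman, Comm. Math. Phys. 86 (1982), Prop. 5.3, Prop. 12.1 [AizenmanCMP1982].
* R. Panis, arXiv:2309.05797 (2023), Prop. 4.6, §4.2 [Panis2023Triviality].
* D. Brydges, J. Fröhlich, A. Sokal, *The random-walk representation of classical spin systems and correlation
  inequalities II. The skeleton inequalities*, Comm. Math. Phys. 91 (1983) 117–139, §4, (4.5) and (4.13)–(4.15)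
  (random-walk analogues for φ⁴; Remark p. 129 on Aizenman's Prop. 12.1 and its constant `3/2`)
  [BrydgesFrohlichSokal1983] (read pp. 127–130).
-/

noncomputable section

open Finset
open scoped symmDiff ENNReal

namespace Literature.Probability.LatticeModels

/-! ### The pairing functional indexed by finite subsets -/

section Pairing

variable {ι : Type*} [LinearOrder ι]

/-- **The Gaussian pairing functional of a finite index set**, `𝒢[S₂](B) = ∑_{π pairing of B} ∏_{{i,j}∈π} S₂(i,j)`,
defined by expansion at the least element `m` of `B`: `𝒢(∅) = 1`, `𝒢(B) = ∑_{j∈B∖m} S₂(m,j) 𝒢(B∖{m,j})`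
(so `𝒢(B) = 0` for `|B|` odd). [cite: AizenmanDuminilCopinAnnals2021, arXiv:1912.07973 §1.1, display defining 𝒢_n (p. 3)] -/
def fsPairing (S₂ : ι → ι → ℝ) (B : Finset ι) : ℝ :=
  if hB : B.Nonempty then
    ∑ j ∈ (B.erase (B.min' hB)).attach, S₂ (B.min' hB) j * fsPairing S₂ ((B.erase (B.min' hB)).erase j)
  else 1
termination_by B.card
decreasing_by
  calc ((B.erase (B.min' hB)).erase ↑j).card < (B.erase (B.min' hB)).card := Finset.card_erase_lt_of_mem j.2
    _ < B.card := Finset.card_erase_lt_of_mem (B.min'_mem hB)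

/-- `𝒢(∅) = 1`. [folklore] -/
@[simp] theorem fsPairing_empty (S₂ : ι → ι → ℝ) : fsPairing S₂ (∅ : Finset ι) = 1 := by
  rw [fsPairing, dif_neg Finset.not_nonempty_empty]

/-- **Expansion at the least element**: `𝒢(B) = ∑_{j∈B∖m} S₂(m,j) 𝒢(B∖{m,j})`, `m = min B`. [folklore] -/
theorem fsPairing_eq (S₂ : ι → ι → ℝ) {B : Finset ι} (hB : B.Nonempty) :
    fsPairing S₂ B = ∑ j ∈ B.erase (B.min' hB), S₂ (B.min' hB) j * fsPairing S₂ ((B.erase (B.min' hB)).erase j) := by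
  rw [fsPairing, dif_pos hB, Finset.sum_attach ((B.erase (B.min' hB)))
    (fun j => S₂ (B.min' hB) j * fsPairing S₂ ((B.erase (B.min' hB)).erase j))]

/-- Strict sub-finsets used in the recursions: `B ∖ {m, j} ⊂ B` for `m ∈ B`. [folklore] -/
theorem erase_erase_ssubset {B : Finset ι} {m : ι} (hm : m ∈ B) (j : ι) : (B.erase m).erase j ⊂ B :=
  lt_of_le_of_lt (Finset.erase_subset j _) (Finset.erase_ssubset hm)

/-- `𝒢 ≥ 0` for `S₂ ≥ 0`. [folklore] -/
theorem fsPairing_nonneg {S₂ : ι → ι → ℝ} (hS : ∀ i j, 0 ≤ S₂ i j) (B : Finset ι) : 0 ≤ fsPairing S₂ B := by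
  induction B using Finset.strongInduction with
  | H B ih =>
    by_cases hB : B.Nonempty
    · rw [fsPairing_eq S₂ hB]
      exact Finset.sum_nonneg fun j _ => mul_nonneg (hS _ _) (ih _ (erase_erase_ssubset (B.min'_mem hB) j))
    · rw [Finset.not_nonempty_iff_eq_empty.1 hB, fsPairing_empty]; exact zero_le_one

/-- **The tree remainder** `ℛ[T,S₂](B) = ∑_{s ⊆ B, |s| = 4} T(s) 𝒢[S₂](B ∖ s)` (the right-hand side of
Aizenman's Prop. 12.1 with the tree diagram `T` for `|U₄|`). [cite: AizenmanCMP1982, Prop. 12.1 (definition of R_{2n})] -/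
def fsRemainder (T : Finset ι → ℝ) (S₂ : ι → ι → ℝ) (B : Finset ι) : ℝ :=
  ∑ s ∈ B.powersetCard 4, T s * fsPairing S₂ (B \ s)

/-- `ℛ ≥ 0` for `T, S₂ ≥ 0`. [folklore] -/
theorem fsRemainder_nonneg {T : Finset ι → ℝ} {S₂ : ι → ι → ℝ} (hT : ∀ s, 0 ≤ T s) (hS : ∀ i j, 0 ≤ S₂ i j)
    (B : Finset ι) : 0 ≤ fsRemainder T S₂ B :=
  Finset.sum_nonneg fun s _ => mul_nonneg (hT s) (fsPairing_nonneg hS _)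

/-- The least element of `B` is the least element of every subset of `B` containing it. [folklore] -/
theorem min'_eq_of_subset {B C : Finset ι} (hB : B.Nonempty) (hC : C.Nonempty) (hCB : C ⊆ B)
    (hm : B.min' hB ∈ C) : C.min' hC = B.min' hB :=
  le_antisymm (Finset.min'_le C _ hm) (Finset.le_min' _ _ _ fun y hy => Finset.min'_le B y (hCB hy))

/-- **Recursion of the tree remainder** at the least element `m` of `B`:
`ℛ(B) = ∑_{j∈B∖m} S₂(m,j) ℛ(B∖{m,j}) + ∑_{s' ⊆ B∖m, |s'|=3} T({m}∪s') 𝒢(B∖({m}∪s'))`. [folklore] -/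
theorem fsRemainder_eq (T : Finset ι → ℝ) (S₂ : ι → ι → ℝ) {B : Finset ι} (hB : B.Nonempty) :
    fsRemainder T S₂ B =
      ∑ j ∈ B.erase (B.min' hB), S₂ (B.min' hB) j * fsRemainder T S₂ ((B.erase (B.min' hB)).erase j) +
        ∑ s ∈ (B.erase (B.min' hB)).powersetCard 3,
          T (insert (B.min' hB) s) * fsPairing S₂ (B \ insert (B.min' hB) s) := by
  set m := B.min' hB with hm
  set B' := B.erase m with hB'
  have hmB : m ∈ B := B.min'_mem hB
  have hmB' : m ∉ B' := Finset.notMem_erase m B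
  have hBins : B = insert m B' := (Finset.insert_erase hmB).symm
  -- split the 4-subsets according to `m ∈ s`
  have hsplit : fsRemainder T S₂ B =
      ∑ s ∈ B'.powersetCard 4, T s * fsPairing S₂ (B \ s) +
        ∑ s ∈ B'.powersetCard 3, T (insert m s) * fsPairing S₂ (B \ insert m s) := by
    unfold fsRemainder
    rw [hBins, Finset.powersetCard_succ_insert hmB', Finset.sum_union, Finset.sum_image, ← hBins]
    · intro s hs t ht hst
      have hms : m ∉ s := fun h => hmB' ((Finset.mem_powersetCard.1 hs).1 h)
      have hmt : m ∉ t := fun h => hmB' ((Finset.mem_powersetCard.1 ht).1 h)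
      rw [← Finset.erase_insert hms, ← Finset.erase_insert hmt, hst]
    · rw [Finset.disjoint_left]
      intro s hs hs'
      obtain ⟨t, -, rfl⟩ := Finset.mem_image.1 hs'
      exact hmB' ((Finset.mem_powersetCard.1 hs).1 (Finset.mem_insert_self m t))
  rw [hsplit]
  congr 1
  -- the 4-subsets avoiding `m`: expand `𝒢(B∖s)` at its least element `m`, then exchange the sums
  have hexp : ∀ s ∈ B'.powersetCard 4, T s * fsPairing S₂ (B \ s) =
      ∑ j ∈ B' \ s, S₂ m j * (T s * fsPairing S₂ ((B'.erase j) \ s)) := by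
    intro s hs
    have hsB' : s ⊆ B' := (Finset.mem_powersetCard.1 hs).1
    have hms : m ∉ s := fun h => hmB' (hsB' h)
    have hne : (B \ s).Nonempty := ⟨m, Finset.mem_sdiff.2 ⟨hmB, hms⟩⟩
    have hmin : (B \ s).min' hne = m := min'_eq_of_subset hB hne Finset.sdiff_subset (Finset.mem_sdiff.2 ⟨hmB, hms⟩)
    have h1 : (B \ s).erase m = B' \ s := by rw [hB']; exact (Finset.erase_sdiff_comm B s m).symm
    have h2 : ∀ j, (B' \ s).erase j = (B'.erase j) \ s := fun j => (Finset.erase_sdiff_comm B' s j).symm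
    rw [fsPairing_eq S₂ hne, Finset.mul_sum]
    simp only [hmin, h1, h2]
    exact Finset.sum_congr rfl fun j _ => by ring
  have hex : ∑ s ∈ B'.powersetCard 4, ∑ j ∈ B' \ s, S₂ m j * (T s * fsPairing S₂ ((B'.erase j) \ s)) =
      ∑ j ∈ B', ∑ s ∈ (B'.erase j).powersetCard 4, S₂ m j * (T s * fsPairing S₂ ((B'.erase j) \ s)) := by
    refine Finset.sum_comm' fun s j => ?_
    simp only [Finset.mem_powersetCard, Finset.mem_sdiff, Finset.subset_erase]
    tauto
  rw [Finset.sum_congr rfl hexp, hex]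
  refine Finset.sum_congr rfl fun j _ => ?_
  rw [fsRemainder, Finset.mul_sum]

/-- **The greedy-pairing recursion (lower bound).** If every Gaussian step is an upper bound,
`S(B) ≤ ∑_{j∈B∖m} S₂(m,j) S(B∖{m,j})` (`m = min B`, `|B|` even, nonempty) and `S(∅) ≤ 1`, `S₂ ≥ 0`, then
`S(B) ≤ 𝒢[S₂](B)` for all `B` of even size (Newman's Gaussian inequality by iteration). [cite: AizenmanDuminilCopinAnnals2021, arXiv:1912.07973 §6.3, first display, lower inequality (p. 26)] -/
theorem le_fsPairing_of_step {S₂ : ι → ι → ℝ} {S : Finset ι → ℝ} (hS2 : ∀ i j, 0 ≤ S₂ i j) (hS0 : S ∅ ≤ 1)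
    (hstep : ∀ (B : Finset ι) (hB : B.Nonempty), Even B.card →
      S B ≤ ∑ j ∈ B.erase (B.min' hB), S₂ (B.min' hB) j * S ((B.erase (B.min' hB)).erase j)) :
    ∀ B : Finset ι, Even B.card → S B ≤ fsPairing S₂ B := by
  intro B
  induction B using Finset.strongInduction with
  | H B ih =>
    intro hev
    by_cases hB : B.Nonempty
    · rw [fsPairing_eq S₂ hB]
      refine (hstep B hB hev).trans (Finset.sum_le_sum fun j hj => mul_le_mul_of_nonneg_left ?_ (hS2 _ _))
      refine ih _ (erase_erase_ssubset (B.min'_mem hB) j) ?_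
      rw [Finset.card_erase_of_mem hj, Finset.card_erase_of_mem (B.min'_mem hB)]
      rcases hev with ⟨r, hr⟩
      refine ⟨r - 1, ?_⟩
      have : 2 ≤ B.card := by
        have h1 : 1 ≤ (B.erase (B.min' hB)).card := Finset.card_pos.2 ⟨j, hj⟩
        rw [Finset.card_erase_of_mem (B.min'_mem hB)] at h1
        omega
      omega
    · rw [Finset.not_nonempty_iff_eq_empty.1 hB, fsPairing_empty]; exact hS0

/-- **The greedy-pairing recursion (upper bound).** If the excess of every Gaussian step is bounded by the
tree terms through the least element, `∑_{j∈B∖m} S₂(m,j) S(B∖{m,j}) - S(B) ≤ c ∑_{s'⊆B∖m,|s'|=3} T({m}∪s') 𝒢(B∖({m}∪s'))`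
(`m = min B`, `|B|` even, nonempty), and `1 ≤ S(∅)`, `S₂, T, c ≥ 0`, then `𝒢[S₂](B) - S(B) ≤ c ℛ[T,S₂](B)` for all
`B` of even size: `𝒢(B) - S(B) = ∑_j S₂(m,j)(𝒢 - S)(B∖{m,j}) + excess`, and the recursion of `ℛ`
(`fsRemainder_eq`) closes the induction. [cite: AizenmanCMP1982, Prop. 12.1 (structure of the bound)] -/
theorem fsPairing_sub_le_of_step {S₂ : ι → ι → ℝ} {T : Finset ι → ℝ} {S : Finset ι → ℝ} {c : ℝ}
    (hS2 : ∀ i j, 0 ≤ S₂ i j) (hS0 : 1 ≤ S ∅)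
    (hstep : ∀ (B : Finset ι) (hB : B.Nonempty), Even B.card →
      ∑ j ∈ B.erase (B.min' hB), S₂ (B.min' hB) j * S ((B.erase (B.min' hB)).erase j) - S B ≤
        c * ∑ s ∈ (B.erase (B.min' hB)).powersetCard 3,
          T (insert (B.min' hB) s) * fsPairing S₂ (B \ insert (B.min' hB) s)) :
    ∀ B : Finset ι, Even B.card → fsPairing S₂ B - S B ≤ c * fsRemainder T S₂ B := by
  intro B
  induction B using Finset.strongInduction with
  | H B ih =>
    intro hev
    by_cases hB : B.Nonempty
    · have hcard : ∀ j ∈ B.erase (B.min' hB), Even ((B.erase (B.min' hB)).erase j).card := by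
        intro j hj
        rw [Finset.card_erase_of_mem hj, Finset.card_erase_of_mem (B.min'_mem hB)]
        rcases hev with ⟨r, hr⟩
        refine ⟨r - 1, ?_⟩
        have : 2 ≤ B.card := by
          have h1 : 1 ≤ (B.erase (B.min' hB)).card := Finset.card_pos.2 ⟨j, hj⟩
          rw [Finset.card_erase_of_mem (B.min'_mem hB)] at h1
          omega
        omega
      have hrec : fsPairing S₂ B - S B =
          ∑ j ∈ B.erase (B.min' hB), S₂ (B.min' hB) j *
              (fsPairing S₂ ((B.erase (B.min' hB)).erase j) - S ((B.erase (B.min' hB)).erase j)) +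
            (∑ j ∈ B.erase (B.min' hB), S₂ (B.min' hB) j * S ((B.erase (B.min' hB)).erase j) - S B) := by
        rw [fsPairing_eq S₂ hB]
        simp only [mul_sub, Finset.sum_sub_distrib]
        ring
      rw [hrec, fsRemainder_eq T S₂ hB, mul_add, Finset.mul_sum]
      refine add_le_add (Finset.sum_le_sum fun j hj => ?_) (hstep B hB hev)
      calc S₂ (B.min' hB) j * (fsPairing S₂ ((B.erase (B.min' hB)).erase j) - S ((B.erase (B.min' hB)).erase j))
          ≤ S₂ (B.min' hB) j * (c * fsRemainder T S₂ ((B.erase (B.min' hB)).erase j)) :=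
            mul_le_mul_of_nonneg_left (ih _ (erase_erase_ssubset (B.min'_mem hB) j) (hcard j hj)) (hS2 _ _)
        _ = c * (S₂ (B.min' hB) j * fsRemainder T S₂ ((B.erase (B.min' hB)).erase j)) := by ring
    · rw [Finset.not_nonempty_iff_eq_empty.1 hB, fsPairing_empty]
      have : fsRemainder T S₂ (∅ : Finset ι) = 0 := by
        rw [fsRemainder, Finset.powersetCard_eq_empty.2 (by simp), Finset.sum_empty]
      rw [this, mul_zero]
      linarith

end Pairing

/-! ### Ordered tuples versus subsets -/

section Tuples

variable {α M : Type*} [DecidableEq α] [AddCommMonoid M]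

/-- `∑_{k∈S} ∑_{l∈S∖k} φ{k,l} = 2 • ∑_{t⊆S,|t|=2} φ(t)` (each pair is enumerated twice). [folklore] -/
theorem sum_sum_erase_eq_two_nsmul (S : Finset α) (φ : Finset α → M) :
    ∑ k ∈ S, ∑ l ∈ S.erase k, φ {k, l} = 2 • ∑ t ∈ S.powersetCard 2, φ t := by
  induction S using Finset.induction_on with
  | empty => rw [Finset.sum_empty, Finset.powersetCard_eq_empty.2 (by simp), Finset.sum_empty, nsmul_zero]
  | @insert a S haS ih =>
    -- the left side
    have hL : ∑ k ∈ insert a S, ∑ l ∈ (insert a S).erase k, φ {k, l} =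
        ∑ k ∈ S, ∑ l ∈ S.erase k, φ {k, l} + 2 • ∑ l ∈ S, φ (insert a {l}) := by
      rw [Finset.sum_insert haS, Finset.erase_insert haS]
      have hk : ∀ k ∈ S, ∑ l ∈ (insert a S).erase k, φ {k, l} = φ (insert a {k}) + ∑ l ∈ S.erase k, φ {k, l} := by
        intro k hk
        have hka : k ≠ a := fun h => haS (h ▸ hk)
        rw [Finset.erase_insert_of_ne hka.symm, Finset.sum_insert (fun h => haS (Finset.mem_of_mem_erase h)),
          Finset.pair_comm]
      rw [Finset.sum_congr rfl hk, Finset.sum_add_distrib, two_nsmul]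
      abel
    -- the right side
    have hR : ∑ t ∈ (insert a S).powersetCard 2, φ t =
        ∑ t ∈ S.powersetCard 2, φ t + ∑ l ∈ S, φ (insert a {l}) := by
      rw [Finset.powersetCard_succ_insert haS, Finset.sum_union, Finset.sum_image, Finset.powersetCard_one,
        Finset.sum_map]
      · rfl
      · intro s hs t ht hst
        have hms : a ∉ s := fun h => haS ((Finset.mem_powersetCard.1 hs).1 h)
        have hmt : a ∉ t := fun h => haS ((Finset.mem_powersetCard.1 ht).1 h)
        rw [← Finset.erase_insert hms, ← Finset.erase_insert hmt, hst]
      · rw [Finset.disjoint_left]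
        intro s hs hs'
        obtain ⟨t, -, rfl⟩ := Finset.mem_image.1 hs'
        exact haS ((Finset.mem_powersetCard.1 hs).1 (Finset.mem_insert_self a t))
    rw [hL, hR, ih, nsmul_add]

/-- `∑_{k∈S} ∑_{l∈S∖k} ∑_{y∈S∖{k,l}} φ{k,l,y} = 6 • ∑_{s⊆S,|s|=3} φ(s)` (each triple is enumerated `3!` times).
[folklore] -/
theorem sum_sum_sum_erase_eq_six_nsmul (S : Finset α) (φ : Finset α → M) :
    ∑ k ∈ S, ∑ l ∈ S.erase k, ∑ y ∈ (S.erase k).erase l, φ {k, l, y} = 6 • ∑ s ∈ S.powersetCard 3, φ s := by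
  induction S using Finset.induction_on with
  | empty => rw [Finset.sum_empty, Finset.powersetCard_eq_empty.2 (by simp), Finset.sum_empty, nsmul_zero]
  | @insert a S haS ih =>
    -- pairs of `S` with `a` adjoined, in the three positions
    set P : M := ∑ k ∈ S, ∑ l ∈ S.erase k, φ (insert a {k, l}) with hP
    have hL : ∑ k ∈ insert a S, ∑ l ∈ (insert a S).erase k, ∑ y ∈ ((insert a S).erase k).erase l, φ {k, l, y} =
        ∑ k ∈ S, ∑ l ∈ S.erase k, ∑ y ∈ (S.erase k).erase l, φ {k, l, y} + 3 • P := by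
      rw [Finset.sum_insert haS, Finset.erase_insert haS]
      -- `k = a`
      have h0 : ∑ l ∈ S, ∑ y ∈ S.erase l, φ {a, l, y} = P := by
        simp only [hP]
      -- `k ∈ S`
      have hk : ∀ k ∈ S, ∑ l ∈ (insert a S).erase k, ∑ y ∈ ((insert a S).erase k).erase l, φ {k, l, y} =
          ∑ y ∈ S.erase k, φ (insert a {k, y}) +
            ∑ l ∈ S.erase k, (φ (insert a {k, l}) + ∑ y ∈ (S.erase k).erase l, φ {k, l, y}) := by
        intro k hk
        have hka : k ≠ a := fun h => haS (h ▸ hk)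
        have haSk : a ∉ S.erase k := fun h => haS (Finset.mem_of_mem_erase h)
        rw [Finset.erase_insert_of_ne hka.symm, Finset.sum_insert haSk, Finset.erase_insert haSk]
        congr 1
        · refine Finset.sum_congr rfl fun y _ => ?_
          rw [Finset.insert_comm]
        · refine Finset.sum_congr rfl fun l hl => ?_
          have hla : l ≠ a := fun h => haSk (h ▸ hl)
          have haSkl : a ∉ (S.erase k).erase l := fun h => haSk (Finset.mem_of_mem_erase h)
          rw [Finset.erase_insert_of_ne hla.symm, Finset.sum_insert haSkl]
          congr 1
          -- `{k, l, a} = insert a {k, l}`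
          rw [show ({k, l, a} : Finset α) = insert a {k, l} by
            ext w; simp only [Finset.mem_insert, Finset.mem_singleton]; tauto]
      rw [h0, Finset.sum_congr rfl hk, Finset.sum_add_distrib, Finset.sum_congr rfl fun k _ => Finset.sum_add_distrib,
        Finset.sum_add_distrib]
      have h3 : (3 : ℕ) • P = P + P + P := by rw [succ_nsmul, two_nsmul]
      rw [h3, hP]
      abel
    have hR : ∑ s ∈ (insert a S).powersetCard 3, φ s = ∑ s ∈ S.powersetCard 3, φ s + ∑ t ∈ S.powersetCard 2, φ (insert a t) := by
      rw [Finset.powersetCard_succ_insert haS, Finset.sum_union, Finset.sum_image]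
      · intro s hs t ht hst
        have hms : a ∉ s := fun h => haS ((Finset.mem_powersetCard.1 hs).1 h)
        have hmt : a ∉ t := fun h => haS ((Finset.mem_powersetCard.1 ht).1 h)
        rw [← Finset.erase_insert hms, ← Finset.erase_insert hmt, hst]
      · rw [Finset.disjoint_left]
        intro s hs hs'
        obtain ⟨t, -, rfl⟩ := Finset.mem_image.1 hs'
        exact haS ((Finset.mem_powersetCard.1 hs).1 (Finset.mem_insert_self a t))
    have hP2 : P = 2 • ∑ t ∈ S.powersetCard 2, φ (insert a t) :=
      sum_sum_erase_eq_two_nsmul S (fun t => φ (insert a t))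
    rw [hL, hR, ih, hP2, nsmul_add, ← mul_nsmul']

end Tuples

/-! ### From current sums to current ratios -/

namespace Current

section Ratios

variable {V : Type*} [Fintype V] [LinearOrder V] {G : SimpleGraph V} [DecidableRel G.Adj] {K : G.edgeFinset → ℝ}

/-- The random-current correlation ratio `W_K(A) = Z_K[A]/Z_K[∅]` (`= ⟨σ_A⟩` for the corresponding Ising /
pair-interaction state, `pairGibbs_spinProduct_eq_wcurrentSum_div`). [cite: Panis2023Triviality, §4.1] -/
def cratio (K : G.edgeFinset → ℝ) (A : Finset V) : ℝ := wcurrentSum K A / wcurrentSum K ∅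

/-- The tree diagram of a vertex set in current ratios, `T(s) = ∑_u ∏_{i∈s} W({i}Δ{u})`
(for `s = {x₁,…,x₄}`: `∑_u ⟨σ_{x₁}σ_u⟩⟨σ_{x₂}σ_u⟩⟨σ_{x₃}σ_u⟩⟨σ_{x₄}σ_u⟩`, Aizenman's tree diagram).
[cite: AizenmanCDM2020, Lemma 8.1, eq. (8.2)] -/
def ctree (K : G.edgeFinset → ℝ) (s : Finset V) : ℝ := ∑ u, ∏ i ∈ s, cratio K ({i} ∆ {u})

/-- `W ≥ 0` for `K ≥ 0`. [cite: GriffithsHurstSherman1970] -/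
theorem cratio_nonneg (hK : ∀ e, 0 ≤ K e) (A : Finset V) : 0 ≤ cratio K A :=
  div_nonneg (wcurrentSum_nonneg hK A) (wcurrentSum_nonneg hK ∅)

/-- `W(∅) = 1`. [folklore] -/
theorem cratio_empty (hK : ∀ e, 0 ≤ K e) : cratio K (∅ : Finset V) = 1 :=
  div_self (wcurrentSum_empty_pos hK).ne'

/-- `T ≥ 0` for `K ≥ 0`. [folklore] -/
theorem ctree_nonneg (hK : ∀ e, 0 ≤ K e) (s : Finset V) : 0 ≤ ctree K s :=
  Finset.sum_nonneg fun _ _ => Finset.prod_nonneg fun _ _ => cratio_nonneg hK _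

omit [Fintype V] in
/-- `B Δ {m} Δ {j} = B ∖ {m, j}` for `m ≠ j` in `B`. [folklore] -/
theorem symmDiff_pair_eq_erase_erase {B : Finset V} {m j : V} (hm : m ∈ B) (hj : j ∈ B) (hmj : m ≠ j) :
    B ∆ ({m} ∆ {j}) = (B.erase m).erase j := by
  ext w
  simp only [Finset.mem_symmDiff, Finset.mem_singleton, Finset.mem_erase]
  constructor
  · rintro (⟨hwB, hw⟩ | ⟨hw, hwB⟩)
    · refine ⟨fun h => hw ?_, fun h => hw ?_, hwB⟩
      · exact Or.inr ⟨h, fun h' => hmj (h'.symm.trans h)⟩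
      · exact Or.inl ⟨h, fun h' => hmj (h.symm.trans h')⟩
    · rcases hw with ⟨rfl, -⟩ | ⟨rfl, -⟩
      · exact absurd hm hwB
      · exact absurd hj hwB
  · rintro ⟨hwj, hwm, hwB⟩
    exact Or.inl ⟨hwB, fun h => h.elim (fun h => hwm h.1) (fun h => hwj h.1)⟩

/-- **The Gaussian step in ratios**: `W(B) ≤ ∑_{j∈B∖v} W({v}Δ{j}) W(B∖{v,j})` for `v ∈ B`, `K ≥ 0`.
[cite: AizenmanDuminilCopinAnnals2021, arXiv:1912.07973 §6.3, first display, lower inequality (p. 26)] -/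
theorem cratio_le_sum (hK : ∀ e, 0 ≤ K e) {B : Finset V} {v : V} (hv : v ∈ B) :
    cratio K B ≤ ∑ j ∈ B.erase v, cratio K ({v} ∆ {j}) * cratio K ((B.erase v).erase j) := by
  have hZ : ∀ A, ecurrentSum K A ≠ ∞ := fun A => ecurrentSum_ne_top hK A
  have h := ecurrentSum_mul_empty_le_sum hK B hv
  have htop : ∑ y ∈ B.erase v, ecurrentSum K ({v} ∆ {y}) * ecurrentSum K (B ∆ ({v} ∆ {y})) ≠ ∞ :=
    ENNReal.sum_ne_top.2 fun y _ => ENNReal.mul_ne_top (hZ _) (hZ _)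
  have h' := ENNReal.toReal_mono htop h
  rw [ENNReal.toReal_mul, ENNReal.toReal_sum (fun y _ => ENNReal.mul_ne_top (hZ _) (hZ _))] at h'
  simp only [ENNReal.toReal_mul, toReal_ecurrentSum hK] at h'
  have h0 : 0 < wcurrentSum K (∅ : Finset V) := wcurrentSum_empty_pos hK
  have hterm : ∀ j ∈ B.erase v, wcurrentSum K ({v} ∆ {j}) * wcurrentSum K (B ∆ ({v} ∆ {j})) =
      cratio K ({v} ∆ {j}) * cratio K ((B.erase v).erase j) * (wcurrentSum K ∅ * wcurrentSum K ∅) := by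
    intro j hj
    rw [symmDiff_pair_eq_erase_erase hv (Finset.mem_of_mem_erase hj) (Finset.ne_of_mem_erase hj).symm, cratio, cratio]
    field_simp
  rw [Finset.sum_congr rfl hterm, ← Finset.sum_mul] at h'
  have h'' : cratio K B * (wcurrentSum K ∅ * wcurrentSum K ∅) ≤
      (∑ j ∈ B.erase v, cratio K ({v} ∆ {j}) * cratio K ((B.erase v).erase j)) * (wcurrentSum K ∅ * wcurrentSum K ∅) := by
    calc cratio K B * (wcurrentSum K ∅ * wcurrentSum K ∅) = wcurrentSum K B * wcurrentSum K ∅ := by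
          rw [cratio]; field_simp
      _ ≤ _ := h'
  exact le_of_mul_le_mul_right h'' (mul_pos h0 h0)

/-- **Newman's Gaussian inequality in ratios** (by the greedy recursion `le_fsPairing_of_step`):
`W(B) ≤ 𝒢[W₂](B)` for `|B|` even, `W₂(a,b) = W({a}Δ{b})`. [cite: AizenmanDuminilCopinAnnals2021, arXiv:1912.07973 §6.3, first display, lower inequality (p. 26)] -/
theorem cratio_le_fsPairing (hK : ∀ e, 0 ≤ K e) {B : Finset V} (hB : Even B.card) :
    cratio K B ≤ fsPairing (fun a b => cratio K ({a} ∆ {b})) B :=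
  le_fsPairing_of_step (S₂ := fun a b => cratio K ({a} ∆ {b})) (S := cratio K)
    (fun _ _ => cratio_nonneg hK _) (cratio_empty hK).le (fun B hB _ => cratio_le_sum hK (B.min'_mem hB)) B hB

/-- The excess-of-Gaussian-step bound of `TreeGraphWickCurrents` in real current sums `Z_K[A] = wcurrentSum K A`.
[cite: AizenmanCMP1982, Prop. 12.1 with Prop. 5.3] -/
theorem three_mul_gaussianDefect_le_tree_real (hK : ∀ e, 0 ≤ K e) {Y : Finset V} {y₁ : V} (hy : y₁ ∈ Y) :
    3 * (∑ j ∈ Y.erase y₁, wcurrentSum K (Y ∆ ({y₁} ∆ {j})) * wcurrentSum K ({y₁} ∆ {j})) * wcurrentSum K ∅ ^ 3 ≤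
      3 * (wcurrentSum K Y * wcurrentSum K ∅ ^ 4) +
        ∑ k ∈ Y.erase y₁, ∑ l ∈ (Y.erase y₁).erase k, ∑ u, ∑ y ∈ (Y ∆ ({k} ∆ {l})).erase y₁,
          wcurrentSum K ({k} ∆ {u}) * wcurrentSum K ({l} ∆ {u}) * wcurrentSum K ({y₁} ∆ {u}) *
            (wcurrentSum K ({u} ∆ {y}) * wcurrentSum K ((Y ∆ ({k} ∆ {l})) ∆ ({y₁} ∆ {y}))) := by
  have h := three_mul_gaussianDefect_le_tree hK hy
  have he : ∀ A, ecurrentSum K A = (((wcurrentSum K A).toNNReal : NNReal) : ℝ≥0∞) := fun A => by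
    rw [ecurrentSum_eq_ofReal hK]; rfl
  simp_rw [he] at h
  have h2 : 3 * (∑ j ∈ Y.erase y₁, (wcurrentSum K (Y ∆ ({y₁} ∆ {j}))).toNNReal * (wcurrentSum K ({y₁} ∆ {j})).toNNReal) *
        (wcurrentSum K ∅).toNNReal ^ 3 ≤
      3 * ((wcurrentSum K Y).toNNReal * (wcurrentSum K ∅).toNNReal ^ 4) +
        ∑ k ∈ Y.erase y₁, ∑ l ∈ (Y.erase y₁).erase k, ∑ u, ∑ y ∈ (Y ∆ ({k} ∆ {l})).erase y₁,
          (wcurrentSum K ({k} ∆ {u})).toNNReal * (wcurrentSum K ({l} ∆ {u})).toNNReal *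
            (wcurrentSum K ({y₁} ∆ {u})).toNNReal *
            ((wcurrentSum K ({u} ∆ {y})).toNNReal * (wcurrentSum K ((Y ∆ ({k} ∆ {l})) ∆ ({y₁} ∆ {y}))).toNNReal) := by
    exact_mod_cast h
  have h3 := NNReal.coe_le_coe.2 h2
  push_cast at h3
  simp only [Real.coe_toNNReal _ (wcurrentSum_nonneg hK _)] at h3
  exact h3

omit [Fintype V] in
/-- `(B ∖ {k,l}) Δ {m} Δ {y} = B ∖ {m,k,l,y}` for distinct `m, y ∈ B ∖ {k,l}`. [folklore] -/
theorem erase_erase_symmDiff_pair_eq_sdiff {B : Finset V} {m k l y : V} (hm : m ∈ B) (hy : y ∈ B)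
    (hmk : m ≠ k) (hml : m ≠ l) (hmy : m ≠ y) (hky : k ≠ y) (hly : l ≠ y) :
    ((B.erase k).erase l) ∆ ({m} ∆ {y}) = B \ insert m {k, l, y} := by
  ext w
  simp only [Finset.mem_symmDiff, Finset.mem_erase, Finset.mem_sdiff, Finset.mem_insert, Finset.mem_singleton]
  grind

omit [Fintype V] in
/-- `(B Δ {k} Δ {l}) ∖ m = B ∖ {m,k,l}` as iterated erasures, for `k ≠ l` in `B`. [folklore] -/
theorem symmDiff_pair_erase_eq {B : Finset V} {m k l : V} (hk : k ∈ B) (hl : l ∈ B) (hkl : k ≠ l) :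
    (B ∆ ({k} ∆ {l})).erase m = ((B.erase m).erase k).erase l := by
  ext w
  simp only [Finset.mem_symmDiff, Finset.mem_erase, Finset.mem_singleton]
  grind

omit [Fintype V] in
/-- `∏_{i ∈ {m,k,l,y}} f i = f m · f k · f l · f y` for distinct points. [folklore] -/
theorem prod_insert_three {m k l y : V} (hmk : m ≠ k) (hml : m ≠ l) (hmy : m ≠ y) (hkl : k ≠ l) (hky : k ≠ y)
    (hly : l ≠ y) (f : V → ℝ) : ∏ i ∈ insert m ({k, l, y} : Finset V), f i = f m * (f k * (f l * f y)) := by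
  rw [Finset.prod_insert, Finset.prod_insert, Finset.prod_insert, Finset.prod_singleton]
  · simp [hly]
  · simp [hkl, hky]
  · simp [hmk, hml, hmy]

/-- **The excess of the Gaussian step is bounded by tree diagrams, in ratios**: for `K ≥ 0`, `m ∈ B`,
`∑_{j∈B∖m} W({m}Δ{j}) W(B∖{m,j}) - W(B) ≤ 2 ∑_{s ⊆ B∖m, |s| = 3} T({m}∪s) · W(B ∖ ({m}∪s))`
(divide `three_mul_gaussianDefect_le_tree` by `Z[∅]⁵` and regroup the ordered triples `(k,l,y)` into
`3!` copies of each `3`-subset). [cite: AizenmanCMP1982, Prop. 12.1 with Prop. 5.3] [cite: Panis2023Triviality, Prop. 4.6 and §4.2] -/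
theorem gaussianExcess_cratio_le (hK : ∀ e, 0 ≤ K e) {B : Finset V} {m : V} (hm : m ∈ B) :
    ∑ j ∈ B.erase m, cratio K ({m} ∆ {j}) * cratio K ((B.erase m).erase j) - cratio K B ≤
      2 * ∑ s ∈ (B.erase m).powersetCard 3, ctree K (insert m s) * cratio K (B \ insert m s) := by
  have hr := three_mul_gaussianDefect_le_tree_real hK hm
  set S : Finset V := B.erase m with hS
  set Z0 : ℝ := wcurrentSum K ∅ with hZ0
  have h0 : 0 < Z0 := wcurrentSum_empty_pos hK
  have hw : ∀ A, wcurrentSum K A = cratio K A * Z0 := fun A => by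
    rw [cratio, ← hZ0, div_mul_cancel₀ _ h0.ne']
  -- rewrite every current sum as ratio × Z[∅] and cancel `Z[∅]⁵`
  have hL : 3 * (∑ j ∈ S, wcurrentSum K (B ∆ ({m} ∆ {j})) * wcurrentSum K ({m} ∆ {j})) * Z0 ^ 3 =
      (3 * ∑ j ∈ S, cratio K (B ∆ ({m} ∆ {j})) * cratio K ({m} ∆ {j})) * Z0 ^ 5 := by
    rw [Finset.mul_sum, Finset.mul_sum, Finset.sum_mul, Finset.sum_mul]
    exact Finset.sum_congr rfl fun j _ => by rw [hw (B ∆ ({m} ∆ {j})), hw ({m} ∆ {j})]; ring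
  have hR : 3 * (wcurrentSum K B * Z0 ^ 4) +
      ∑ k ∈ S, ∑ l ∈ S.erase k, ∑ u, ∑ y ∈ (B ∆ ({k} ∆ {l})).erase m,
        wcurrentSum K ({k} ∆ {u}) * wcurrentSum K ({l} ∆ {u}) * wcurrentSum K ({m} ∆ {u}) *
          (wcurrentSum K ({u} ∆ {y}) * wcurrentSum K ((B ∆ ({k} ∆ {l})) ∆ ({m} ∆ {y}))) =
      (3 * cratio K B + ∑ k ∈ S, ∑ l ∈ S.erase k, ∑ u, ∑ y ∈ (B ∆ ({k} ∆ {l})).erase m,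
        cratio K ({k} ∆ {u}) * cratio K ({l} ∆ {u}) * cratio K ({m} ∆ {u}) *
          (cratio K ({u} ∆ {y}) * cratio K ((B ∆ ({k} ∆ {l})) ∆ ({m} ∆ {y})))) * Z0 ^ 5 := by
    rw [add_mul]
    congr 1
    · rw [hw B]; ring
    · simp only [Finset.sum_mul]
      refine Finset.sum_congr rfl fun k _ => Finset.sum_congr rfl fun l _ => Finset.sum_congr rfl fun u _ =>
        Finset.sum_congr rfl fun y _ => ?_
      rw [hw ({k} ∆ {u}), hw ({l} ∆ {u}), hw ({m} ∆ {u}), hw ({u} ∆ {y}), hw ((B ∆ ({k} ∆ {l})) ∆ ({m} ∆ {y}))]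
      ring
  rw [hL, hR] at hr
  have hr' := le_of_mul_le_mul_right hr (pow_pos h0 5)
  -- the left side in the announced form
  have hleft : ∑ j ∈ S, cratio K (B ∆ ({m} ∆ {j})) * cratio K ({m} ∆ {j}) =
      ∑ j ∈ S, cratio K ({m} ∆ {j}) * cratio K (S.erase j) := by
    refine Finset.sum_congr rfl fun j hj => ?_
    rw [symmDiff_pair_eq_erase_erase hm (Finset.mem_of_mem_erase hj) (Finset.ne_of_mem_erase hj).symm, mul_comm]
  -- the right side regrouped over `3`-subsets
  set φ : Finset V → ℝ := fun s => ctree K (insert m s) * cratio K (B \ insert m s) with hφ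
  have hright : ∑ k ∈ S, ∑ l ∈ S.erase k, ∑ u, ∑ y ∈ (B ∆ ({k} ∆ {l})).erase m,
        cratio K ({k} ∆ {u}) * cratio K ({l} ∆ {u}) * cratio K ({m} ∆ {u}) *
          (cratio K ({u} ∆ {y}) * cratio K ((B ∆ ({k} ∆ {l})) ∆ ({m} ∆ {y}))) =
      ∑ k ∈ S, ∑ l ∈ S.erase k, ∑ y ∈ (S.erase k).erase l, φ {k, l, y} := by
    refine Finset.sum_congr rfl fun k hk => Finset.sum_congr rfl fun l hl => ?_
    have hkB : k ∈ B := Finset.mem_of_mem_erase hk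
    have hmk : m ≠ k := (Finset.ne_of_mem_erase hk).symm
    have hlS : l ∈ S := Finset.mem_of_mem_erase hl
    have hlB : l ∈ B := Finset.mem_of_mem_erase hlS
    have hml : m ≠ l := (Finset.ne_of_mem_erase hlS).symm
    have hkl : k ≠ l := (Finset.ne_of_mem_erase hl).symm
    rw [symmDiff_pair_erase_eq hkB hlB hkl, ← hS, Finset.sum_comm]
    refine Finset.sum_congr rfl fun y hy => ?_
    have hyS : y ∈ S := Finset.mem_of_mem_erase (Finset.mem_of_mem_erase hy)
    have hyB : y ∈ B := Finset.mem_of_mem_erase hyS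
    have hmy : m ≠ y := (Finset.ne_of_mem_erase hyS).symm
    have hky : k ≠ y := (Finset.ne_of_mem_erase (Finset.mem_of_mem_erase hy)).symm
    have hly : l ≠ y := (Finset.ne_of_mem_erase hy).symm
    simp only [hφ, ctree, Finset.sum_mul]
    refine Finset.sum_congr rfl fun u _ => ?_
    rw [prod_insert_three hmk hml hmy hkl hky hly, symmDiff_pair_eq_erase_erase hkB hlB hkl,
      erase_erase_symmDiff_pair_eq_sdiff hm hyB hmk hml hmy hky hly, symmDiff_comm ({u} : Finset V) {y}]
    ring
  rw [hleft, hright, sum_sum_sum_erase_eq_six_nsmul S φ, nsmul_eq_mul] at hr'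
  push_cast at hr'
  linarith

/-- **The tree-graph bound on the deviation from Wick's law, for current ratios and distinct points.**
For edge couplings `K ≥ 0` on a finite simple graph and every vertex set `B` of even size,
`𝒢[W₂](B) - W(B) ≤ 2 ℛ[T,W₂](B)`, i.e.
`∑_{pairings} ∏ W({a}Δ{b}) - W(B) ≤ 2 ∑_{s⊆B,|s|=4} (∑_u ∏_{i∈s} W({i}Δ{u})) 𝒢[W₂](B∖s)` —
the tree-diagram form of Aizenman 1982, Prop. 12.1 (with the tree diagram bound Prop. 5.3 in place of `|U₄|`,
constant `2` in place of `(3/2)·2`), by the greedy-pairing recursion from `gaussianExcess_cratio_le`.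
[cite: AizenmanCMP1982, Prop. 12.1 and Prop. 5.3] [cite: Panis2023Triviality, Prop. 4.6 and §4.2 (tree diagram bound)] [cite: BrydgesFrohlichSokal1983, §4 eqs. (4.13)–(4.15)] -/
theorem fsPairing_sub_cratio_le (hK : ∀ e, 0 ≤ K e) {B : Finset V} (hB : Even B.card) :
    fsPairing (fun a b => cratio K ({a} ∆ {b})) B - cratio K B ≤
      2 * fsRemainder (ctree K) (fun a b => cratio K ({a} ∆ {b})) B := by
  refine fsPairing_sub_le_of_step (S₂ := fun a b => cratio K ({a} ∆ {b})) (S := cratio K) (T := ctree K)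
    (fun _ _ => cratio_nonneg hK _) (cratio_empty hK).ge (fun B hB hev => ?_) B hB
  refine (gaussianExcess_cratio_le hK (B.min'_mem hB)).trans ?_
  rw [Finset.mul_sum, Finset.mul_sum]
  refine Finset.sum_le_sum fun s hs => ?_
  have hsS : s ⊆ B.erase (B.min' hB) := (Finset.mem_powersetCard.1 hs).1
  have hcard : s.card = 3 := (Finset.mem_powersetCard.1 hs).2
  have hms : B.min' hB ∉ s := fun h => Finset.notMem_erase _ _ (hsS h)
  have hsub : insert (B.min' hB) s ⊆ B :=
    Finset.insert_subset (B.min'_mem hB) (hsS.trans (Finset.erase_subset _ _))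
  have heven : Even (B \ insert (B.min' hB) s).card := by
    rw [Finset.card_sdiff_of_subset hsub, Finset.card_insert_of_notMem hms, hcard]
    rcases hev with ⟨r, hr⟩
    refine ⟨r - 2, ?_⟩
    have : 4 ≤ B.card := by
      have h := Finset.card_le_card hsub
      rw [Finset.card_insert_of_notMem hms, hcard] at h
      exact h
    omega
  exact mul_le_mul_of_nonneg_left
    (mul_le_mul_of_nonneg_left (cratio_le_fsPairing hK heven) (ctree_nonneg hK _)) (by norm_num)

/-- **Both bounds together**: `|W(B) - 𝒢[W₂](B)| ≤ 2 ℛ[T,W₂](B)` for `|B|` even (the lower bound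
`W ≤ 𝒢` is Newman's Gaussian inequality `cratio_le_fsPairing`). [cite: AizenmanCMP1982, Prop. 12.1 and Prop. 5.3] [cite: Panis2023Triviality, Prop. 4.6 and §4.2] -/
theorem abs_cratio_sub_fsPairing_le (hK : ∀ e, 0 ≤ K e) {B : Finset V} (hB : Even B.card) :
    |cratio K B - fsPairing (fun a b => cratio K ({a} ∆ {b})) B| ≤
      2 * fsRemainder (ctree K) (fun a b => cratio K ({a} ∆ {b})) B := by
  rw [abs_sub_le_iff]
  refine ⟨?_, fsPairing_sub_cratio_le hK hB⟩
  have h1 := cratio_le_fsPairing hK hB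
  have h2 : 0 ≤ fsRemainder (ctree K) (fun a b => cratio K ({a} ∆ {b})) B :=
    fsRemainder_nonneg (ctree_nonneg hK) (fun _ _ => cratio_nonneg hK _) B
  linarith

end Ratios

end Current

end Literature.Probability.LatticeModels

end
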